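import Summits.MatrixMultiplication.OmegaCensus.DominoZpZpStructSevenKeys
import HarnessLib

/-!
# Structural cover argument for part size `7`: arrangement generators with proved completeness

ω-census `pub-omega`, family (b3), seat pub-omega-group gen 24.  Framing: lottery ticket; floor = certified bounds/negative
ranges.  VALUE: kernel-cheap enumeration of the pinned families of the part-`7` pair checks (`DominoZpZpStructSevenCheck.lean`).
The part-`6` route enumerated arrangements by `p⁵` nested loops and therefore had to hoist them into literal lists with per-
representative completeness decides; for septuples (`p⁶` loops, families of ≈ 9 000 arrangements at `p = 11`) that is out of
reach, so here the arrangements of a multiset are generated OUTPUT-SENSITIVELY (`msArr`: pick the next value among those with a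
positive remaining count) and completeness is a THEOREM (`mem_msArr`): every list of length `n` with entries `< p` and count
vector `k` is produced.  On top: `vals7`/count bookkeeping for septuples, the sortedness test `isSortedB`, and the four family
generators `arr7Y2` (`y₀ = y₂`), `arr7Y3` (`y₀ = y₃`), `arr7TN` (`x₀ = x₁ = x₂`, entries `4,5,6` sorted) and `arr7PN`
(`x₀ = x₁ ≤ x₂ = x₃`, entries `4,5,6` sorted) with their completeness lemmas; NOT progress on ω.
-/

namespace Summit.MatrixMultiplication.OmegaCensus

open Finset

namespace ZpZpDomino

/-! ## Multiset arrangements -/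

section MsArr

/-- Decrement entry `v` of a count vector. [folklore] -/
def decr (k : List ℕ) (v : ℕ) : List ℕ := k.set v (k.getD v 0 - 1)

/-- All arrangements (lists of length `n`, entries `< p`) drawing each value `v` at most `k[v]` times — for `n = Σ k` exactly
the arrangements of the multiset with count vector `k`; output-sensitive recursion. [folklore] -/
def msArr (p : ℕ) : ℕ → List ℕ → List (List ℕ)
  | 0, _ => [[]]
  | n + 1, k => (List.range p).flatMap fun v => if k.getD v 0 == 0 then [] else (msArr p n (decr k v)).map (v :: ·)

/-- Entries of `List.set` (with default `0`). [folklore] -/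
theorem getD_set_eq (k : List ℕ) : ∀ (v w a : ℕ),
    (k.set v a).getD w 0 = if w = v ∧ v < k.length then a else k.getD w 0 := by
  induction k with
  | nil => intro v w a; simp
  | cons x xs ih =>
    intro v w a
    cases v with
    | zero => cases w <;> simp
    | succ v =>
      cases w with
      | zero => simp
      | succ w =>
        simp only [List.set_cons_succ, List.getD_cons_succ, ih, List.length_cons, Nat.succ_lt_succ_iff,
          Nat.succ_inj]

/-- Entries of `decr`. [folklore] -/
theorem getD_decr (k : List ℕ) (v w : ℕ) :
    (decr k v).getD w 0 = if w = v then k.getD v 0 - 1 else k.getD w 0 := by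
  unfold decr
  rw [getD_set_eq]
  by_cases hwv : w = v
  · subst hwv
    by_cases hlt : w < k.length
    · rw [if_pos ⟨rfl, hlt⟩, if_pos rfl]
    · rw [if_neg (fun h => hlt h.2), if_pos rfl, List.getD_eq_getElem?_getD, List.getElem?_eq_none (by omega)]
      rfl
  · rw [if_neg (fun h => hwv h.1), if_neg hwv]

/-- **Completeness of `msArr`**: a list of length `n` with entries `< p` whose counts are bounded by `k` is produced. [folklore] -/
theorem mem_msArr (p : ℕ) : ∀ (n : ℕ) (k t : List ℕ), t.length = n → (∀ v ∈ t, v < p) →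
    (∀ v, t.count v ≤ k.getD v 0) → t ∈ msArr p n k
  | 0, k, t, hlen, _, _ => by
    rw [List.length_eq_zero_iff] at hlen
    subst hlen
    simp [msArr]
  | n + 1, k, t, hlen, hlt, hcnt => by
    obtain ⟨v, t', rfl⟩ := List.exists_cons_of_length_eq_add_one hlen
    simp only [List.length_cons, Nat.add_right_cancel_iff] at hlen
    have hv : v < p := hlt v (by simp)
    have hkv : 1 ≤ k.getD v 0 := le_trans (by simp) (hcnt v)
    rw [msArr, List.mem_flatMap]
    refine ⟨v, List.mem_range.2 hv, ?_⟩
    rw [if_neg (by rw [beq_iff_eq]; omega), List.mem_map]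
    refine ⟨t', mem_msArr p n (decr k v) t' hlen (fun w hw => hlt w (by simp [hw])) fun w => ?_, rfl⟩
    rw [getD_decr]
    have hc := hcnt w
    rw [List.count_cons] at hc
    by_cases hwv : w = v
    · subst hwv
      rw [if_pos rfl]
      simp only [beq_self_eq_true, ite_true] at hc
      omega
    · rw [if_neg hwv]
      have : (v == w) = false := beq_eq_false_iff_ne.2 (Ne.symm hwv)
      simp only [this] at hc
      simpa using hc

end MsArr

/-! ## Septuple values and counts -/

section Vals

variable {p : ℕ}

/-- The list of values of a septuple. [folklore] -/
def vals7 (a : Fin 7 → ZMod p) : List ℕ := [(a 0).val, (a 1).val, (a 2).val, (a 3).val, (a 4).val, (a 5).val, (a 6).val]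

/-- Entries of `vals7`. [folklore] -/
theorem getD_vals7 (a : Fin 7 → ZMod p) (k : Fin 7) : (vals7 a).getD k.val 0 = (a k).val := by
  fin_cases k <;> rfl

/-- Counting a value in an explicit cons. [folklore] -/
theorem count_cons_nat (b v : ℕ) (l : List ℕ) : (b :: l).count v = l.count v + if b = v then 1 else 0 := by
  rw [List.count_cons]
  by_cases h : b = v
  · rw [if_pos h, beq_iff_eq.2 h]; rfl
  · rw [if_neg h, beq_eq_false_iff_ne.2 h]; rfl

variable [Fact p.Prime]

/-- **Counts of `vals7` are the key entries.** [folklore] -/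
theorem count_vals7 (a : Fin 7 → ZMod p) (v : ℕ) : (vals7 a).count v = (key7 a).getD v 0 := by
  by_cases hv : v < p
  · rw [getD_key7 a hv, Fin.sum_univ_seven, vals7]
    simp only [count_cons_nat, List.count_nil]
    ring
  · have h0 : (key7 a).getD v 0 = 0 := by
      rw [List.getD_eq_getElem?_getD, List.getElem?_eq_none (by rw [length_key7]; omega)]; rfl
    rw [h0, List.count_eq_zero]
    intro hm
    simp only [vals7, List.mem_cons, List.not_mem_nil, or_false] at hm
    rcases hm with h | h | h | h | h | h | h <;> exact hv (h ▸ ZMod.val_lt _)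

/-- Entries of `vals7` are `< p`. [folklore] -/
theorem lt_of_mem_vals7 (a : Fin 7 → ZMod p) : ∀ v ∈ vals7 a, v < p := by
  intro v hm
  simp only [vals7, List.mem_cons, List.not_mem_nil, or_false] at hm
  rcases hm with h | h | h | h | h | h | h <;> exact h ▸ ZMod.val_lt _

end Vals

/-! ## Family generators -/

section Families

/-- `[b, c, d, e]` with `c ≤ d ≤ e`. [folklore] -/
def sortedTail4 : List ℕ → Bool
  | [_, c, d, e] => decide (c ≤ d) && decide (d ≤ e)
  | _ => false

/-- `[c, d, e]` with `c ≤ d ≤ e`. [folklore] -/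
def sorted3 : List ℕ → Bool
  | [c, d, e] => decide (c ≤ d) && decide (d ≤ e)
  | _ => false

/-- Arrangements `[a, b, a, c, d, e, f]` (`y₀ = y₂`) of the multiset with count vector `k`. [folklore] -/
def arr7Y2 (p : ℕ) (k : List ℕ) : List (List ℕ) :=
  (List.range p).flatMap fun a => if k.getD a 0 < 2 then [] else
    (msArr p 5 (decr (decr k a) a)).map fun t => match t with
      | b :: r => a :: b :: a :: r
      | [] => []

/-- Arrangements `[a, b, c, a, d, e, f]` (`y₀ = y₃`). [folklore] -/
def arr7Y3 (p : ℕ) (k : List ℕ) : List (List ℕ) :=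
  (List.range p).flatMap fun a => if k.getD a 0 < 2 then [] else
    (msArr p 5 (decr (decr k a) a)).map fun t => match t with
      | b :: c :: r => a :: b :: c :: a :: r
      | _ => []

/-- NORMALISED arrangements `[a, a, a, b, c, d, e]` (`x₀ = x₁ = x₂`, `c ≤ d ≤ e`). [folklore] -/
def arr7TN (p : ℕ) (k : List ℕ) : List (List ℕ) :=
  (List.range p).flatMap fun a => if k.getD a 0 < 3 then [] else
    ((msArr p 4 (decr (decr (decr k a) a) a)).filter sortedTail4).map fun t => a :: a :: a :: t

/-- NORMALISED arrangements `[a, a, b, b, c, d, e]` (`x₀ = x₁ = a ≤ b = x₂ = x₃`, `c ≤ d ≤ e`). [folklore] -/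
def arr7PN (p : ℕ) (k : List ℕ) : List (List ℕ) :=
  (List.range p).flatMap fun a => if k.getD a 0 < 2 then [] else
    (List.range p).flatMap fun b => if decide (b < a) || decide ((decr (decr k a) a).getD b 0 < 2) then [] else
      ((msArr p 3 (decr (decr (decr (decr k a) a) b) b)).filter sorted3).map fun t => a :: a :: b :: b :: t

variable {p : ℕ} [Fact p.Prime]

/-- Count bookkeeping: removing `c` copies of `a` from a count vector. [folklore] -/
theorem count_le_decr {full t k : List ℕ} {a c : ℕ} (hk : ∀ v, full.count v = k.getD v 0)
    (hcnt : ∀ v, full.count v = t.count v + if a = v then c else 0) :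
    ∀ v, t.count v ≤ (if v = a then k.getD a 0 - c else k.getD v 0) := by
  intro v
  have h1 := hk v
  rw [hcnt v] at h1
  by_cases hva : v = a
  · subst hva; rw [if_pos rfl] at h1; rw [if_pos rfl]; omega
  · rw [if_neg (Ne.symm hva)] at h1; rw [if_neg hva]; omega

/-- Two decrements at `a`. [folklore] -/
theorem getD_decr2 (k : List ℕ) (a v : ℕ) :
    (decr (decr k a) a).getD v 0 = if v = a then k.getD a 0 - 2 else k.getD v 0 := by
  rw [getD_decr, getD_decr, getD_decr, if_pos rfl]
  by_cases hva : v = a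
  · rw [if_pos hva, if_pos hva]; omega
  · rw [if_neg hva, if_neg hva, if_neg hva]

/-- Three decrements at `a`. [folklore] -/
theorem getD_decr3 (k : List ℕ) (a v : ℕ) :
    (decr (decr (decr k a) a) a).getD v 0 = if v = a then k.getD a 0 - 3 else k.getD v 0 := by
  rw [getD_decr, getD_decr2, getD_decr2, if_pos rfl]
  by_cases hva : v = a
  · rw [if_pos hva, if_pos hva]; omega
  · rw [if_neg hva, if_neg hva, if_neg hva]

/-- `vals7 y ∈ arr7Y2 p (key7 y)` for `y 0 = y 2`. [folklore] -/
theorem vals_mem_arr7Y2 (y : Fin 7 → ZMod p) (h02 : y 0 = y 2) : vals7 y ∈ arr7Y2 p (key7 y) := by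
  have hv : vals7 y = (y 0).val :: (y 1).val :: (y 0).val :: [(y 3).val, (y 4).val, (y 5).val, (y 6).val] := by
    rw [vals7, ← h02]
  have hcnt : ∀ v, (vals7 y).count v =
      [(y 1).val, (y 3).val, (y 4).val, (y 5).val, (y 6).val].count v + if (y 0).val = v then 2 else 0 := by
    intro v; rw [hv]; simp only [count_cons_nat, List.count_nil]; split_ifs <;> ring
  have hle := count_le_decr (fun v => count_vals7 y v) hcnt
  have hka : 2 ≤ (key7 y).getD (y 0).val 0 := by
    have := count_vals7 y (y 0).val; rw [hcnt, if_pos rfl] at this; omega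
  rw [arr7Y2, List.mem_flatMap]
  refine ⟨(y 0).val, List.mem_range.2 (ZMod.val_lt _), ?_⟩
  rw [if_neg (by omega), List.mem_map]
  refine ⟨[(y 1).val, (y 3).val, (y 4).val, (y 5).val, (y 6).val], mem_msArr p 5 _ _ rfl (fun v hm => ?_) fun v => ?_,
    by rw [hv]⟩
  · simp only [List.mem_cons, List.not_mem_nil, or_false] at hm
    rcases hm with h | h | h | h | h <;> exact h ▸ ZMod.val_lt _
  · rw [getD_decr2]; exact hle v

/-- `vals7 y ∈ arr7Y3 p (key7 y)` for `y 0 = y 3`. [folklore] -/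
theorem vals_mem_arr7Y3 (y : Fin 7 → ZMod p) (h03 : y 0 = y 3) : vals7 y ∈ arr7Y3 p (key7 y) := by
  have hv : vals7 y = (y 0).val :: (y 1).val :: (y 2).val :: (y 0).val :: [(y 4).val, (y 5).val, (y 6).val] := by
    rw [vals7, ← h03]
  have hcnt : ∀ v, (vals7 y).count v =
      [(y 1).val, (y 2).val, (y 4).val, (y 5).val, (y 6).val].count v + if (y 0).val = v then 2 else 0 := by
    intro v; rw [hv]; simp only [count_cons_nat, List.count_nil]; split_ifs <;> ring
  have hle := count_le_decr (fun v => count_vals7 y v) hcnt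
  have hka : 2 ≤ (key7 y).getD (y 0).val 0 := by
    have := count_vals7 y (y 0).val; rw [hcnt, if_pos rfl] at this; omega
  rw [arr7Y3, List.mem_flatMap]
  refine ⟨(y 0).val, List.mem_range.2 (ZMod.val_lt _), ?_⟩
  rw [if_neg (by omega), List.mem_map]
  refine ⟨[(y 1).val, (y 2).val, (y 4).val, (y 5).val, (y 6).val], mem_msArr p 5 _ _ rfl (fun v hm => ?_) fun v => ?_,
    by rw [hv]⟩
  · simp only [List.mem_cons, List.not_mem_nil, or_false] at hm
    rcases hm with h | h | h | h | h <;> exact h ▸ ZMod.val_lt _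
  · rw [getD_decr2]; exact hle v

/-- `vals7 x ∈ arr7TN p (key7 x)` for `x 0 = x 1 = x 2` with entries `4, 5, 6` sorted. [folklore] -/
theorem vals_mem_arr7TN (x : Fin 7 → ZMod p) (h01 : x 0 = x 1) (h12 : x 1 = x 2)
    (h45 : (x 4).val ≤ (x 5).val) (h56 : (x 5).val ≤ (x 6).val) : vals7 x ∈ arr7TN p (key7 x) := by
  have hv : vals7 x = (x 0).val :: (x 0).val :: (x 0).val :: [(x 3).val, (x 4).val, (x 5).val, (x 6).val] := by
    rw [vals7, ← h12, ← h01]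
  have hcnt : ∀ v, (vals7 x).count v =
      [(x 3).val, (x 4).val, (x 5).val, (x 6).val].count v + if (x 0).val = v then 3 else 0 := by
    intro v; rw [hv]; simp only [count_cons_nat]; split_ifs <;> ring
  have hle := count_le_decr (fun v => count_vals7 x v) hcnt
  have hka : 3 ≤ (key7 x).getD (x 0).val 0 := by
    have := count_vals7 x (x 0).val; rw [hcnt, if_pos rfl] at this; omega
  rw [arr7TN, List.mem_flatMap]
  refine ⟨(x 0).val, List.mem_range.2 (ZMod.val_lt _), ?_⟩
  rw [if_neg (by omega), List.mem_map]
  refine ⟨[(x 3).val, (x 4).val, (x 5).val, (x 6).val],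
    List.mem_filter.2 ⟨mem_msArr p 4 _ _ rfl (fun v hm => ?_) fun v => ?_, ?_⟩, by rw [hv]⟩
  · simp only [List.mem_cons, List.not_mem_nil, or_false] at hm
    rcases hm with h | h | h | h <;> exact h ▸ ZMod.val_lt _
  · rw [getD_decr3]; exact hle v
  · rw [sortedTail4, Bool.and_eq_true, decide_eq_true_eq, decide_eq_true_eq]; exact ⟨h45, h56⟩

/-- `vals7 x ∈ arr7PN p (key7 x)` for `x 0 = x 1`, `x 2 = x 3`, `(x 0).val ≤ (x 2).val`, entries `4, 5, 6` sorted. [folklore] -/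
theorem vals_mem_arr7PN (x : Fin 7 → ZMod p) (h01 : x 0 = x 1) (h23 : x 2 = x 3) (h02 : (x 0).val ≤ (x 2).val)
    (h45 : (x 4).val ≤ (x 5).val) (h56 : (x 5).val ≤ (x 6).val) : vals7 x ∈ arr7PN p (key7 x) := by
  have hv : vals7 x = (x 0).val :: (x 0).val :: (x 2).val :: (x 2).val :: [(x 4).val, (x 5).val, (x 6).val] := by
    rw [vals7, ← h23, ← h01]
  -- remove the two copies of `x 0`, then the two copies of `x 2`
  have hcnt1 : ∀ v, (vals7 x).count v =
      ((x 2).val :: (x 2).val :: [(x 4).val, (x 5).val, (x 6).val]).count v + if (x 0).val = v then 2 else 0 := by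
    intro v; rw [hv]; simp only [count_cons_nat]; split_ifs <;> ring
  have hcnt2 : ∀ v, ((x 2).val :: (x 2).val :: [(x 4).val, (x 5).val, (x 6).val]).count v =
      [(x 4).val, (x 5).val, (x 6).val].count v + if (x 2).val = v then 2 else 0 := by
    intro v; simp only [count_cons_nat]; split_ifs <;> ring
  have hle1 := count_le_decr (fun v => count_vals7 x v) hcnt1
  have hk1 : ∀ v, ((x 2).val :: (x 2).val :: [(x 4).val, (x 5).val, (x 6).val]).count v ≤
      (decr (decr (key7 x) (x 0).val) (x 0).val).getD v 0 := fun v => by rw [getD_decr2]; exact hle1 v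
  have hka : 2 ≤ (key7 x).getD (x 0).val 0 := by
    have := count_vals7 x (x 0).val; rw [hcnt1, if_pos rfl] at this; omega
  have hkb : 2 ≤ (decr (decr (key7 x) (x 0).val) (x 0).val).getD (x 2).val 0 := by
    have := hk1 (x 2).val; rw [hcnt2, if_pos rfl] at this; omega
  rw [arr7PN, List.mem_flatMap]
  refine ⟨(x 0).val, List.mem_range.2 (ZMod.val_lt _), ?_⟩
  rw [if_neg (by omega), List.mem_flatMap]
  refine ⟨(x 2).val, List.mem_range.2 (ZMod.val_lt _), ?_⟩
  rw [if_neg (by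
    rw [Bool.or_eq_true, decide_eq_true_eq, decide_eq_true_eq]; push Not; exact ⟨h02, hkb⟩), List.mem_map]
  refine ⟨[(x 4).val, (x 5).val, (x 6).val],
    List.mem_filter.2 ⟨mem_msArr p 3 _ _ rfl (fun v hm => ?_) fun v => ?_, ?_⟩, by rw [hv]⟩
  · simp only [List.mem_cons, List.not_mem_nil, or_false] at hm
    rcases hm with h | h | h <;> exact h ▸ ZMod.val_lt _
  · rw [getD_decr2]
    have h1 := hk1 v
    rw [hcnt2 v] at h1
    by_cases hvb : v = (x 2).val
    · subst hvb; rw [if_pos rfl] at h1; rw [if_pos rfl]; omega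
    · rw [if_neg (Ne.symm hvb)] at h1; rw [if_neg hvb]; omega
  · rw [sorted3, Bool.and_eq_true, decide_eq_true_eq, decide_eq_true_eq]; exact ⟨h45, h56⟩

end Families

end ZpZpDomino

end Summit.MatrixMultiplication.OmegaCensus
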